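/-
Copyright: the b2b-balaban cell (near-miss cell 7), T⁴-continuum fan-out; row NE7b ROUND-2 swarm, seat
t4-ne7b-formalise-leaf-04 (gen 2) — row S6g′(a) pt 2 «THE LAW», file 1∕2 (split agreed with leaf-10 g2, journal
l.8499 ∕ l.8537; holder of row (a): t4-ne7b-formalise-leaf-01).  Released under the licence of the surrounding project.
-/
import Summits.QuantumFields.BalabanUV.T4Continuum.Support.HistoryZoneMass
import Summits.QuantumFields.BalabanUV.T4Continuum.Support.HistoryZonesDropsRegions

/-!
# Zone evolution and the ancestor decomposition of a tolerant zone (row S6g′(a) pt 2, file 1∕2)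

Summits-side support leaf of the T⁴-continuum cell (rung (B)+1 on a FINITE torus only; NOT infinite volume, NOT the
mass gap, NOT the Clay statement; NOT a proof of the spine estimate NE7b).  Row NE7b, route «COUNT», row S6g′
«MASS-BASED SIBLING COUNT» (R-OWNER-22-12 (2)), step (a) = the CARDINALITY LAW of the zone reading; this file is the
set-and-tree half of its proof (leaf-10 g2's route, journal l.8499 (2)(i)), the law itself is
`Support/HistoryZoneMassLaw`.  [folklore] finite geometry + structural recursion on leaf-01's tolerant reading
`HistoryZonesTolerant.ZoneReadingC`, with leaf-10 g2's `HistoryZoneMass` (`blocks_thickT_subset`,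
`thickT_thickT_subset`, `card_thickT_le`) and leaf-07 g2's `HistoryZones.blocks_blocks`∕`blocks_one` BY NAME; nothing
is quoted from print, nothing printed is asserted, no `[cite:]` tag, no `Prop`-valued fact minted; constants symbolic.

WHAT.  §1 `side n L K t = n·L^{K−t}`; **`evolve n L K c u k S`** = the `k`-fold tolerant evolution of a set from step
`u` (block by `L`, thicken by `c` on the next torus, `k` times): `evolve_union`, `evolve_mono`, `evolve_empty`,
**`evolve_add`** (composition), `inRange_evolve`; the collapsed radius **`cth c L k`** (`cth 0 = 0`,
`cth (k+1) = c + cth k ∕ L + 1`, monotone) and **`evolve_subset_thickT_blocks`**: `k` tolerant steps lie in ONE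
blocking by `L^k` and ONE thickening by `cth c L k`; hence **`card_evolve_le`**: `#evolve ≤ (2·cth k + 1)^d·#blocks (L^k)`.
§2 for a tagged genealogy read by `ZoneReadingC sh n L K Cb c G zone`: `zone_subset_evolve` (a sub-structure's zone
`k` steps after a step it is formed by lies in the evolution of its zone then); the PIECES **`parts sh t₀ X`** relative
to a cut `t₀` (maximal sub-structures formed BEFORE `t₀`, births from `t₀` on; renewals transparent, recent mergers
split), `sub_of_mem_parts`, `parts_cases`, the start time `ustart` (`t₀ − 1` for an ancestor, its step for a recent
birth), `st_le_ftime_of_chrono`, `ftime_le_of_sub`, list unions `lunion`∕`mem_lunion`∕`card_lunion_le`, and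
**`zone_subset_parts`** (chronological reading, `X` formed by `t`, `t₀ ≤ t + 1`): `zone t X ⊆ ⋃_{p ∈ parts t₀ X}
evolve (ustart p) (t − ustart p) (zone (ustart p) p)`.  §3 sanity.

HONEST: bookkeeping on OUR reading; NE7b NOT proved; spine 0∕9.  HONEST DEPENDENCY (cell): continuum YM on T⁴ ⇐
BetaPertH ∧ nine spine estimates (0/9 proved); BetaPertH ⇐ (D1) ∧ (D4) ∧ CAP+tail.  This file changes none of it.
-/

open Finset
open Literature.MathematicalPhysics.QuantumFieldTheory.Balaban1983to89
open T4PersistenceDictionary T4PartnerMultiplicity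
open Summit.QuantumFields.BalabanUV.T4Continuum.PlacementSkeleton
open Summit.QuantumFields.BalabanUV.T4Continuum.Crowding
open Summit.QuantumFields.BalabanUV.T4Continuum.ZoneSkeleton
open Summit.QuantumFields.BalabanUV.T4Continuum.ZoneTorus
open Summit.QuantumFields.BalabanUV.T4Continuum.HistoryZones
open Summit.QuantumFields.BalabanUV.T4Continuum.HistoryZoneMass

namespace Summit.QuantumFields.BalabanUV.T4Continuum.HistoryZoneEvolve

noncomputable section

variable {d : ℕ}

/-! ## §1 The tolerant evolution of a set over `k` steps -/

section Evolve

/-- the torus side at step `t`: `n·L^{K−t}` [folklore] -/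
def side (n L K t : ℕ) : ℕ := n * L ^ (K - t)

/-- `side` `k` steps earlier is `L^k` times `side` [folklore] -/
theorem side_add {n L K u k : ℕ} (h : u + k ≤ K) : side n L K u = side n L K (u + k) * L ^ k := by
  rw [side, side, mul_assoc, ← pow_add]; congr 2; omega

/-- **THE `k`-FOLD TOLERANT EVOLUTION** of a set from step `u`: at each step, block by `L` and thicken by `c` on the
next torus. [folklore] -/
def evolve (n L K c u : ℕ) : ℕ → Finset (Fin d → ℕ) → Finset (Fin d → ℕ)
  | 0, S => S
  | k + 1, S => thickT (side n L K (u + k + 1)) c (blocks L (evolve n L K c u k S))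

variable {n L K c : ℕ}

/-- nothing evolves from nothing [folklore] -/
theorem evolve_empty (u : ℕ) : ∀ k : ℕ, evolve n L K c u k (∅ : Finset (Fin d → ℕ)) = ∅
  | 0 => rfl
  | k + 1 => by
      show thickT _ c (blocks L (evolve n L K c u k ∅)) = ∅
      rw [evolve_empty u k, blocks, image_empty]
      ext u; simp [mem_thickT]

/-- evolution distributes over unions [folklore] -/
theorem evolve_union (u : ℕ) : ∀ (k : ℕ) (S T : Finset (Fin d → ℕ)),
    evolve n L K c u k (S ∪ T) = evolve n L K c u k S ∪ evolve n L K c u k T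
  | 0, _, _ => rfl
  | k + 1, S, T => by
      show thickT _ c (blocks L (evolve n L K c u k (S ∪ T))) = thickT _ c _ ∪ thickT _ c _
      rw [evolve_union u k S T, blocks, image_union, thickT_union]; rfl

/-- evolution is monotone [folklore] -/
theorem evolve_mono (u : ℕ) : ∀ (k : ℕ) {S T : Finset (Fin d → ℕ)}, S ⊆ T →
    evolve n L K c u k S ⊆ evolve n L K c u k T
  | 0, _, _, h => h
  | k + 1, _, _, h => thickT_mono _ _ (image_subset_image (evolve_mono u k h))

/-- evolutions compose: `k′` steps from `u + k` after `k` steps from `u` are `k + k′` steps from `u` [folklore] -/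
theorem evolve_add (u k : ℕ) : ∀ (k' : ℕ) (S : Finset (Fin d → ℕ)),
    evolve n L K c (u + k) k' (evolve n L K c u k S) = evolve n L K c u (k + k') S
  | 0, _ => rfl
  | k' + 1, S => by
      show thickT (side n L K (u + k + k' + 1)) c (blocks L (evolve n L K c (u + k) k' (evolve n L K c u k S))) =
        thickT (side n L K (u + (k + k') + 1)) c (blocks L (evolve n L K c u (k + k') S))
      rw [evolve_add u k k' S]
      simp only [Nat.add_assoc]

/-- evolution is in range of its torus [folklore] -/
theorem inRange_evolve (u : ℕ) {S : Finset (Fin d → ℕ)} (hS : InRange (side n L K u) S) :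
    ∀ k : ℕ, InRange (side n L K (u + k)) (evolve n L K c u k S)
  | 0 => hS
  | _ + 1 => inRange_thickT _ _ _

/-- **THE THICKENING RADIUS OF `k` COLLAPSED STEPS**: `cth 0 = 0`, `cth (k+1) = c + cth k ∕ L + 1`. [folklore] -/
def cth (c L : ℕ) : ℕ → ℕ
  | 0 => 0
  | k + 1 => c + (cth c L k / L + 1)

/-- `cth` is monotone in the number of steps [folklore] -/
theorem cth_mono (c L : ℕ) : ∀ {k k' : ℕ}, k ≤ k' → cth c L k ≤ cth c L k'
  | 0, _, _ => Nat.zero_le _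
  | _ + 1, 0, h => absurd h (Nat.not_succ_le_zero _)
  | k + 1, k' + 1, h => by
      have ih := cth_mono c L (Nat.le_of_succ_le_succ h)
      show c + (cth c L k / L + 1) ≤ c + (cth c L k' / L + 1)
      have := Nat.div_le_div_right (c := L) ih
      omega

/-- **`k` TOLERANT STEPS COLLAPSE INTO ONE BLOCKING BY `L^k` AND ONE THICKENING BY `cth k`.** [folklore] -/
theorem evolve_subset_thickT_blocks (hL : 1 ≤ L) (u : ℕ) {S : Finset (Fin d → ℕ)} (hS : InRange (side n L K u) S) :
    ∀ k : ℕ, u + k ≤ K → evolve n L K c u k S ⊆ thickT (side n L K (u + k)) (cth c L k) (blocks (L ^ k) S)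
  | 0, _ => by
      show S ⊆ thickT (side n L K (u + 0)) 0 (blocks (L ^ 0) S)
      rw [pow_zero, blocks_one]
      exact subset_thickT 0 hS
  | k + 1, hk => by
      have ih := evolve_subset_thickT_blocks hL u hS k (Nat.le_of_succ_le hk)
      have hsd : side n L K (u + k) = side n L K (u + k + 1) * L := by
        have e : side n L K (u + k) = side n L K (u + k + 1) * L ^ 1 := side_add (by omega)
        rwa [pow_one] at e
      have hSe : side n L K u = side n L K (u + k + 1) * L ^ (k + 1) := side_add hk
      have h1 : blocks L (evolve n L K c u k S) ⊆
          thickT (side n L K (u + k + 1)) (cth c L k / L + 1) (blocks (L ^ (k + 1)) S) := by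
        refine (image_subset_image ih).trans ?_
        rw [hsd]
        refine (blocks_thickT_subset hL _ _ _).trans (le_of_eq ?_)
        rw [blocks_blocks, ← pow_succ]
      have hR : InRange (side n L K (u + k + 1)) (blocks (L ^ (k + 1)) S) :=
        inRange_blocks (Nat.one_le_pow _ _ hL) (by rw [← hSe]; exact hS)
      show thickT (side n L K (u + k + 1)) c (blocks L (evolve n L K c u k S)) ⊆ _
      exact (thickT_mono _ _ h1).trans (thickT_thickT_subset c _ hR)

/-- **THE CARDINALITY OF AN EVOLUTION**: `#evolve u k S ≤ (2·cth k + 1)^d · #blocks (L^k) S`. [folklore] -/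
theorem card_evolve_le (hL : 1 ≤ L) (u : ℕ) {S : Finset (Fin d → ℕ)} (hS : InRange (side n L K u) S) {k : ℕ}
    (hk : u + k ≤ K) : (evolve n L K c u k S).card ≤ (2 * cth c L k + 1) ^ d * (blocks (L ^ k) S).card := by
  have hSe : side n L K u = side n L K (u + k) * L ^ k := side_add hk
  have hR : InRange (side n L K (u + k)) (blocks (L ^ k) S) :=
    inRange_blocks (Nat.one_le_pow _ _ hL) (by rw [← hSe]; exact hS)
  exact (card_le_card (evolve_subset_thickT_blocks hL u hS k hk)).trans (card_thickT_le _ hR)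

end Evolve

/-! ## §2 The ancestor decomposition of a zone -/

section Parts

variable {ε : Type*} (sh : ε → PEv)

/-- **THE PIECES OF `X` RELATIVE TO THE CUT `t₀`**: the maximal sub-structures formed BEFORE `t₀` (ancestors) and the
births from `t₀` on; renewals are transparent; a merger from `t₀` on splits into the pieces of its partners. [folklore] -/
def parts (t₀ : ℕ) : Gen ε → List (Gen ε)
  | Gen.born b j => [Gen.born b j]
  | Gen.renew Y _ _ => parts t₀ Y
  | Gen.merge Y Z e => if (sh e).step < t₀ then [Gen.merge Y Z e] else parts t₀ Y ++ parts t₀ Z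

/-- the START TIME of a piece: `t₀ − 1` for an ancestor, its own formation time for a recent birth [folklore] -/
def ustart (t₀ : ℕ) (p : Gen ε) : ℕ := max (t₀ - 1) (ftime (PEv.step ∘ sh) p)

variable {sh}

/-- pieces are sub-structures [folklore] -/
theorem sub_of_mem_parts (t₀ : ℕ) : ∀ {X p : Gen ε}, p ∈ parts sh t₀ X → Sub p X
  | Gen.born b j, p, hp => by
      simp only [parts, List.mem_singleton] at hp; subst hp; exact Sub.refl _
  | Gen.renew Y e h, p, hp => Sub.renew e h (sub_of_mem_parts t₀ (X := Y) hp)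
  | Gen.merge Y Z e, p, hp => by
      simp only [parts] at hp
      split_ifs at hp with hlt
      · simp only [List.mem_singleton] at hp; subst hp; exact Sub.refl _
      · rcases List.mem_append.1 hp with h | h
        · exact Sub.left Z e (sub_of_mem_parts t₀ h)
        · exact Sub.right Y e (sub_of_mem_parts t₀ h)

/-- **CLASSIFICATION**: a piece is an ancestor (formed before `t₀`) or a birth from `t₀` on [folklore] -/
theorem parts_cases (t₀ : ℕ) : ∀ {X p : Gen ε}, p ∈ parts sh t₀ X →
    ftime (PEv.step ∘ sh) p < t₀ ∨ ∃ b j, p = Gen.born b j ∧ t₀ ≤ (sh b).step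
  | Gen.born b j, p, hp => by
      simp only [parts, List.mem_singleton] at hp; subst hp
      by_cases h : (sh b).step < t₀
      · exact Or.inl h
      · exact Or.inr ⟨b, j, rfl, not_lt.1 h⟩
  | Gen.renew Y e h, p, hp => parts_cases t₀ (X := Y) hp
  | Gen.merge Y Z e, p, hp => by
      simp only [parts] at hp
      split_ifs at hp with hlt
      · simp only [List.mem_singleton] at hp; subst hp; exact Or.inl hlt
      · rcases List.mem_append.1 hp with h | h
        · exact parts_cases t₀ h
        · exact parts_cases t₀ h

variable [DecidableEq ε]

/-- under chronology every formation event of a structure is dated no later than its formation time [folklore] -/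
theorem st_le_ftime_of_chrono (st : ε → ℕ) : ∀ {X : Gen ε}, Chrono st X → ∀ w ∈ form X, st w ≤ ftime st X
  | Gen.born b j, _, w, hw => by
      have : w = b := by simpa [form, merges] using hw
      subst this; exact le_rfl
  | Gen.renew Y e h, hc, w, hw => by
      have hw' : w ∈ form Y := by simpa [form, merges] using hw
      exact st_le_ftime_of_chrono st (X := Y) hc w hw'
  | Gen.merge Y Z e, hc, w, hw => by
      obtain ⟨-, -, hle⟩ := hc
      show st w ≤ st e
      have hw' : w ∈ form Y ∪ form Z ∨ w = e := by
        simp only [form, births_merge, merges, mem_union, mem_insert] at hw ⊢; tauto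
      rcases hw' with h | rfl
      · exact hle w h
      · exact le_rfl

/-- under chronology a sub-structure is formed no later than the whole [folklore] -/
theorem ftime_le_of_sub (st : ε → ℕ) : ∀ {p X : Gen ε}, Sub p X → Chrono st X → ftime st p ≤ ftime st X
  | _, _, Sub.refl _, _ => le_rfl
  | _, _, Sub.renew (G := G) e h hs, hc => show _ ≤ ftime st G from ftime_le_of_sub st hs hc
  | _, _, Sub.left B e hs, hc => (ftime_le_of_sub st hs hc.1).trans (ftime_le_of_chrono st hc).1
  | _, _, Sub.right A e hs, hc => (ftime_le_of_sub st hs hc.2.1).trans (ftime_le_of_chrono st hc).2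

omit [DecidableEq ε] in
/-- the union of a list of sets [folklore] -/
def lunion {α : Type*} [DecidableEq α] : List (Finset α) → Finset α
  | [] => ∅
  | S :: l => S ∪ lunion l

omit [DecidableEq ε] in
/-- membership in a list union [folklore] -/
theorem mem_lunion {α : Type*} [DecidableEq α] {u : α} : ∀ {l : List (Finset α)}, u ∈ lunion l ↔ ∃ S ∈ l, u ∈ S
  | [] => by simp [lunion]
  | S :: l => by simp [lunion, mem_lunion (l := l)]

omit [DecidableEq ε] in
/-- the cardinality of a list union is at most the sum [folklore] -/
theorem card_lunion_le {α : Type*} [DecidableEq α] :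
    ∀ l : List (Finset α), ((lunion l).card : ℝ) ≤ (l.map fun S => (S.card : ℝ)).sum
  | [] => by simp [lunion]
  | S :: l => by
      simp only [lunion, List.map_cons, List.sum_cons]
      have h : ((S ∪ lunion l).card : ℝ) ≤ S.card + (lunion l).card := by exact_mod_cast card_union_le S (lunion l)
      linarith [card_lunion_le l]

variable {n L K c : ℕ} {Cb : ℝ} {G : Gen ε} {zone : ℕ → Gen ε → Finset (Fin d → ℕ)}

omit [DecidableEq ε] in
/-- a sub-structure's zone `k` steps after a step it is formed by lies in the evolution of its zone then [folklore] -/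
theorem zone_subset_evolve (hR : ZoneReadingC sh n L K Cb c G zone) {X : Gen ε} (hX : Sub X G) {u : ℕ}
    (hft : ftime (PEv.step ∘ sh) X ≤ u) : ∀ k : ℕ, u + k ≤ K → zone (u + k) X ⊆ evolve n L K c u k (zone u X)
  | 0, _ => subset_rfl
  | k + 1, hk => by
      have ih := zone_subset_evolve hR hX hft k (Nat.le_of_succ_le hk)
      have hstep := hR.step X (u + k) hX (hft.trans (Nat.le_add_right u k)) hk
      show zone (u + k + 1) X ⊆ thickT (side n L K (u + k + 1)) c (blocks L (evolve n L K c u k (zone u X)))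
      exact hstep.trans (thickT_mono _ _ (image_subset_image ih))

omit [DecidableEq ε] in
/-- the evolution of a piece from its start, seen from a later time `s ≥ ustart p`: evolving `zone (ustart p) p` to `s`
and then to `t` is evolving it to `t` [folklore] -/
theorem evolve_piece {t₀ s t : ℕ} {p : Gen ε} (hps : ustart sh t₀ p ≤ s) (hst : s ≤ t) :
    evolve n L K c s (t - s) (evolve n L K c (ustart sh t₀ p) (s - ustart sh t₀ p) (zone (ustart sh t₀ p) p)) =
      evolve n L K c (ustart sh t₀ p) (t - ustart sh t₀ p) (zone (ustart sh t₀ p) p) := by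
  have h := evolve_add (n := n) (L := L) (K := K) (c := c) (ustart sh t₀ p) (s - ustart sh t₀ p) (t - s)
    (zone (ustart sh t₀ p) p)
  rw [Nat.add_sub_cancel' hps] at h
  rw [h, show s - ustart sh t₀ p + (t - s) = t - ustart sh t₀ p by omega]

/-- **THE ANCESTOR DECOMPOSITION**: for a chronological reading, a sub-structure `X` formed by `t ≤ K`, and a cut
`t₀ ≤ t + 1`: `zone t X` lies in the union over the pieces `p ∈ parts t₀ X` of the evolutions of `zone (ustart p) p`
from `ustart p` to `t`. [folklore] -/
theorem zone_subset_parts (hR : ZoneReadingC sh n L K Cb c G zone) (hchr : Chrono (PEv.step ∘ sh) G) (t₀ : ℕ) :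
    ∀ {X : Gen ε}, Sub X G → ∀ {t : ℕ}, t₀ ≤ t + 1 → ftime (PEv.step ∘ sh) X ≤ t → t ≤ K →
      zone t X ⊆ lunion ((parts sh t₀ X).map fun p =>
        evolve n L K c (ustart sh t₀ p) (t - ustart sh t₀ p) (zone (ustart sh t₀ p) p))
  | Gen.born b j, hX, t, ht₀, hft, htK => by
      simp only [parts, List.map_cons, List.map_nil, lunion, union_empty]
      have hfu : ftime (PEv.step ∘ sh) (Gen.born b j) ≤ ustart sh t₀ (Gen.born b j) := le_max_right _ _
      have hut : ustart sh t₀ (Gen.born b j) ≤ t := max_le (by omega) hft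
      have h := zone_subset_evolve hR hX hfu (t - ustart sh t₀ (Gen.born b j)) (by omega)
      rwa [Nat.add_sub_cancel' hut] at h
  | Gen.renew Y e h, hX, t, ht₀, hft, htK => by
      have hY : Sub Y G := Sub.trans (Sub.renew e h (Sub.refl Y)) hX
      exact (hR.renew Y e h t hX).trans (zone_subset_parts hR hchr t₀ hY ht₀ hft htK)
  | Gen.merge Y Z e, hX, t, ht₀, hft, htK => by
      by_cases hlt : (sh e).step < t₀
      · -- an ancestor: evolve its own zone from `t₀ − 1`
        simp only [parts, if_pos hlt, List.map_cons, List.map_nil, lunion, union_empty]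
        have hfu : ftime (PEv.step ∘ sh) (Gen.merge Y Z e) ≤ ustart sh t₀ (Gen.merge Y Z e) := le_max_right _ _
        have hut : ustart sh t₀ (Gen.merge Y Z e) ≤ t := max_le (by omega) hft
        have h := zone_subset_evolve hR hX hfu (t - ustart sh t₀ (Gen.merge Y Z e)) (by omega)
        rwa [Nat.add_sub_cancel' hut] at h
      · -- a recent merger: evolve from the merger step, then decompose the partners there
        simp only [parts, if_neg hlt, List.map_append]
        have hfte : ftime (PEv.step ∘ sh) (Gen.merge Y Z e) = (sh e).step := rfl
        rw [hfte] at hft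
        have hchrX := chrono_of_sub (PEv.step ∘ sh) hX hchr
        obtain ⟨hfY, hfZ⟩ := ftime_le_of_chrono (PEv.step ∘ sh) hchrX
        have hY : Sub Y G := Sub.trans (Sub.left Z e (Sub.refl Y)) hX
        have hZ : Sub Z G := Sub.trans (Sub.right Y e (Sub.refl Z)) hX
        have hsK : (sh e).step ≤ K := hft.trans htK
        have ht₀s : t₀ ≤ (sh e).step + 1 := by omega
        -- the two recursive calls, at the merger step
        have hdY := zone_subset_parts hR hchr t₀ hY ht₀s hfY hsK
        have hdZ := zone_subset_parts hR hchr t₀ hZ ht₀s hfZ hsK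
        -- zone t X ⊆ evolve s (t − s) (zone s Y) ∪ evolve s (t − s) (zone s Z)
        have h0 := zone_subset_evolve hR hX (u := (sh e).step) le_rfl (t - (sh e).step) (by omega)
        rw [Nat.add_sub_cancel' hft] at h0
        have h1 := h0.trans (evolve_mono (sh e).step (t - (sh e).step) (hR.union Y Z e hX))
        rw [evolve_union] at h1
        -- pushing the evolution through a decomposition at the merger step
        have push : ∀ {W : Gen ε}, Sub W G → ftime (PEv.step ∘ sh) W ≤ (sh e).step → ∀ l : List (Gen ε),
            (∀ p ∈ l, p ∈ parts sh t₀ W) →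
            evolve n L K c (sh e).step (t - (sh e).step) (lunion (l.map fun p =>
              evolve n L K c (ustart sh t₀ p) ((sh e).step - ustart sh t₀ p) (zone (ustart sh t₀ p) p))) ⊆
            lunion (l.map fun p =>
              evolve n L K c (ustart sh t₀ p) (t - ustart sh t₀ p) (zone (ustart sh t₀ p) p)) := by
          intro W hW hfW l hl
          induction l with
          | nil => simp [lunion, evolve_empty]
          | cons p l ihl =>
              simp only [List.map_cons, lunion]
              rw [evolve_union]
              refine union_subset_union (le_of_eq ?_) (ihl fun q hq => hl q (List.mem_cons_of_mem _ hq))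
              have hp := hl p List.mem_cons_self
              have hup : ustart sh t₀ p ≤ (sh e).step :=
                max_le (by omega) ((ftime_le_of_sub _ (sub_of_mem_parts t₀ hp)
                  (chrono_of_sub (PEv.step ∘ sh) hW hchr)).trans hfW)
              exact evolve_piece hup hft
        intro z hz
        rw [mem_lunion]
        rcases mem_union.1 (h1 hz) with h | h
        · have h' := push hY hfY _ (fun p hp => hp) (evolve_mono _ _ hdY h)
          obtain ⟨S, hS, hzS⟩ := mem_lunion.1 h'
          exact ⟨S, List.mem_append.2 (Or.inl hS), hzS⟩
        · have h' := push hZ hfZ _ (fun p hp => hp) (evolve_mono _ _ hdZ h)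
          obtain ⟨S, hS, hzS⟩ := mem_lunion.1 h'
          exact ⟨S, List.mem_append.2 (Or.inr hS), hzS⟩

end Parts

/-! ## §3 Sanity (decided) -/

namespace Sanity

/-- the collapsed thickening radii for `c = 2`, `L = 4`: `0, 3, 3, 3` (the recursion stabilises) -/
example : (List.range 4).map (cth 2 4) = [0, 3, 3, 3] := by decide

/-- the pieces of a merger (step `3`) of two births (steps `0` and `2`; shapes read by `Prod.fst`): cut `t₀ = 1` ⇒ the
old birth is an ancestor piece and the young one a recent birth (2 pieces); cut `t₀ = 4` ⇒ the merger is one ancestor -/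
example :
    (parts (Prod.fst : PEv × ℕ → PEv) 1
        (Gen.merge (Gen.born (((0, 0, 5) : PEv), 0) 0) (Gen.born (((2, 0, 1) : PEv), 1) 2)
          (((3, 2, 0) : PEv), 2))).length = 2 ∧
    (parts (Prod.fst : PEv × ℕ → PEv) 4
        (Gen.merge (Gen.born (((0, 0, 5) : PEv), 0) 0) (Gen.born (((2, 0, 1) : PEv), 1) 2)
          (((3, 2, 0) : PEv), 2))).length = 1 := by
  decide

end Sanity

end

end Summit.QuantumFields.BalabanUV.T4Continuum.HistoryZoneEvolve
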